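import Literature.AnabelianGeometry.SemiGraphs.TemperedAnchoredCompactOfAbelianEdges
import Literature.AnabelianGeometry.SemiGraphs.MetabelianLeafStarCor39
import HarnessLib

/-!
# ANCHORED Thm 3.7 (iii)/(iv) HOLD at the rayless star `𝒢⋆(p)`; its escaping compact subgroups are ANCHOR-FREE
# (proof-only, by name)

Mochizuki, *Semi-graphs of anabelioids*, Publ. RIMS **42** (2006), §3, Theorem 3.7 (iii) pp. 40–41, (iv) p. 41
[cite: MochizukiSemiAnbd2006, Thm 3.7(iii) pp.40-41].

PROOF-ONLY file (abc-iut cell, layer L3, row «ANCHORED@STAR», seat abc-iut-w6-d064 gen 7, L3-lead γ68 (3); no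
definition, no named fact).  The instance at abc-iut-L3-t8's rayless star `𝒢⋆(p) = metabelianLeafStar p` (NOT locally
finite; no core, `metabelianLeafStar_noCore`; edge groups `ℤ_p`, commutative) of this seat's class theorem
`exists_verticial_ge_of_inf_verticial_ne_bot_of_noCore_of_commEdges` (`TemperedAnchoredCompactOfAbelianEdges.lean`):

* `metabelianLeafStar_exists_verticial_ge_of_inf_verticial_ne_bot` — at EVERY chart, every compact
  `K ≤ π₁^temp(𝒢⋆(p))` meeting a verticial subgroup non-trivially lies in a verticial subgroup (hypothesis-free);
* `metabelianLeafStar_exists_mem_verticialSubgroups_of_isMaximalCompactSubgroup` — ANCHORED maximal compact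
  subgroups of `π₁^temp(𝒢⋆(p))` are verticial (Thm 3.7 (iv), first clause, anchored form);
* `metabelianLeafStar_le_verticial_or_anchorFree` — dichotomy; `metabelianLeafStar_exists_anchorFree` — since the
  ∃-sentence of Thm 3.7 (iii) FAILS at `𝒢⋆(p)` (abc-iut-L3-t8, `metabelianLeafStar_not_compactInVerticialAt`), some
  chart carries a NON-TRIVIAL compact subgroup lying in no verticial subgroup, and every such subgroup is
  ANCHOR-FREE (meets every verticial subgroup trivially) — exactly as at the locally finite ray `𝒢_θ`, although
  the locally finite anchored package (strong (LE)) does not reach the star.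

Honest framing: statements about OUR typed `π₁^temp(𝒢⋆(p))`; outside the [IUTchIII] Cor 3.12 cone; no side taken
on [IUTchIII] Cor 3.12; typed ≠ proved.
-/

noncomputable section

namespace Literature.AnabelianGeometry.SemiGraphs

namespace ProfiniteSemiGraph

open Topology

variable (p : ℕ) [hp : Fact p.Prime]

/-- The edge groups `Π_e = ℤ_p` of `𝒢⋆(p)` are commutative. [cite: MochizukiSemiAnbd2006, Def 2.1 p.22] -/
theorem metabelianLeafStar_commEdges (e : (metabelianLeafStar p).graph.Edge)
    (k k' : (metabelianLeafStar p).Ge e) : k * k' = k' * k :=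
  mul_comm (G := Multiplicative ℤ_[p]) k k'

/-- **ANCHORED Thm 3.7 (iii), first sentence, at `𝒢⋆(p)`, every chart, hypothesis-free**: every compact
`K ≤ π₁^temp(𝒢⋆(p))` with `K ⊓ H₀ ≠ 1` for some verticial `H₀` lies in a verticial subgroup.
[cite: MochizukiSemiAnbd2006, Thm 3.7(iii) pp.40-41] -/
theorem metabelianLeafStar_exists_verticial_ge_of_inf_verticial_ne_bot (c : TemperedPiChart (metabelianLeafStar p))
    (K : Subgroup c.G) (hKc : IsCompact (K : Set c.G)) {v₀ : (metabelianLeafStar p).graph.Vertex}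
    {H₀ : Subgroup c.G} (hH₀ : H₀ ∈ verticialSubgroups c v₀) (hanch : K ⊓ H₀ ≠ ⊥) :
    ∃ (v : (metabelianLeafStar p).graph.Vertex) (H : Subgroup c.G), H ∈ verticialSubgroups c v ∧ K ≤ H :=
  exists_verticial_ge_of_inf_verticial_ne_bot_of_noCore_of_commEdges (metabelianLeafStar_thm37Hypotheses' p)
    (metabelianLeafStar_noCore p) (metabelianLeafStar_commEdges p) c K hKc hH₀ hanch

/-- With an explicit anchor: a compact `K ≤ π₁^temp(𝒢⋆(p))` containing some `A ≠ 1` that lies in a verticial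
subgroup is contained in a verticial subgroup. [cite: MochizukiSemiAnbd2006, Thm 3.7(iii) pp.40-41] -/
theorem metabelianLeafStar_exists_verticial_ge_of_anchored (c : TemperedPiChart (metabelianLeafStar p))
    (K : Subgroup c.G) (hKc : IsCompact (K : Set c.G)) {A : Subgroup c.G} (hA : A ≠ ⊥) (hAK : A ≤ K)
    {v₀ : (metabelianLeafStar p).graph.Vertex} {H₀ : Subgroup c.G} (hH₀ : H₀ ∈ verticialSubgroups c v₀)
    (hAH₀ : A ≤ H₀) :
    ∃ (v : (metabelianLeafStar p).graph.Vertex) (H : Subgroup c.G), H ∈ verticialSubgroups c v ∧ K ≤ H :=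
  exists_verticial_ge_of_anchored_of_noCore_of_commEdges (metabelianLeafStar_thm37Hypotheses' p)
    (metabelianLeafStar_noCore p) (metabelianLeafStar_commEdges p) c K hKc hA hAK hH₀ hAH₀

/-- **Thm 3.7 (iv), first clause, ANCHORED form, at `𝒢⋆(p)`, every chart**: a maximal compact subgroup of
`π₁^temp(𝒢⋆(p))` meeting some verticial subgroup non-trivially IS a verticial subgroup.
[cite: MochizukiSemiAnbd2006, Thm 3.7(iv) p.41] -/
theorem metabelianLeafStar_exists_mem_verticialSubgroups_of_isMaximalCompactSubgroup
    (c : TemperedPiChart (metabelianLeafStar p)) (K : Subgroup c.G) (hK : IsMaximalCompactSubgroup K)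
    {v₀ : (metabelianLeafStar p).graph.Vertex} {H₀ : Subgroup c.G} (hH₀ : H₀ ∈ verticialSubgroups c v₀)
    (hanch : K ⊓ H₀ ≠ ⊥) : ∃ v : (metabelianLeafStar p).graph.Vertex, K ∈ verticialSubgroups c v :=
  exists_mem_verticialSubgroups_of_isMaximalCompactSubgroup_of_noCore_of_commEdges
    (metabelianLeafStar_thm37Hypotheses' p) (metabelianLeafStar_noCore p) (metabelianLeafStar_commEdges p) c K hK
    hH₀ hanch

/-- **At `𝒢⋆(p)` the violators of the existence sentence are ANCHOR-FREE** (every chart): a compact subgroup of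
`π₁^temp(𝒢⋆(p))` contained in no verticial subgroup meets every verticial subgroup trivially.
[cite: MochizukiSemiAnbd2006, Thm 3.7(iii) pp.40-41] -/
theorem metabelianLeafStar_inf_verticial_eq_bot_of_forall_not_le (c : TemperedPiChart (metabelianLeafStar p))
    (K : Subgroup c.G) (hKc : IsCompact (K : Set c.G))
    (hno : ∀ (v : (metabelianLeafStar p).graph.Vertex) (H : Subgroup c.G), H ∈ verticialSubgroups c v → ¬ K ≤ H)
    {v₀ : (metabelianLeafStar p).graph.Vertex} {H₀ : Subgroup c.G} (hH₀ : H₀ ∈ verticialSubgroups c v₀) :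
    K ⊓ H₀ = ⊥ :=
  inf_verticial_eq_bot_of_forall_not_le_of_noCore_of_commEdges (metabelianLeafStar_thm37Hypotheses' p)
    (metabelianLeafStar_noCore p) (metabelianLeafStar_commEdges p) c K hKc hno hH₀

/-- **Dichotomy at `𝒢⋆(p)`** (every chart): a compact subgroup of `π₁^temp(𝒢⋆(p))` lies in a verticial subgroup or
is anchor-free. [cite: MochizukiSemiAnbd2006, Thm 3.7(iii) pp.40-41] -/
theorem metabelianLeafStar_le_verticial_or_anchorFree (c : TemperedPiChart (metabelianLeafStar p))
    (K : Subgroup c.G) (hKc : IsCompact (K : Set c.G)) :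
    (∃ (v : (metabelianLeafStar p).graph.Vertex) (H : Subgroup c.G), H ∈ verticialSubgroups c v ∧ K ≤ H) ∨
      ∀ (v : (metabelianLeafStar p).graph.Vertex) (H : Subgroup c.G), H ∈ verticialSubgroups c v → K ⊓ H = ⊥ :=
  le_verticial_or_anchorFree_of_noCore_of_commEdges (metabelianLeafStar_thm37Hypotheses' p)
    (metabelianLeafStar_noCore p) (metabelianLeafStar_commEdges p) c K hKc

/-- **`𝒢⋆(p)` carries a NON-TRIVIAL compact ANCHOR-FREE subgroup** (some chart): since the ∃-sentence of
Thm 3.7 (iii) fails at `𝒢⋆(p)` (abc-iut-L3-t8's `metabelianLeafStar_not_compactInVerticialAt`, e.g. the escaping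
procyclic `⟨c⟩‾`), some compact `K` lies in NO verticial subgroup — so `K ≠ 1` (the trivial subgroup lies in the
verticial subgroup of any vertex, which exist by Thm 3.7 (i)) and `K` meets EVERY verticial subgroup trivially.
[cite: MochizukiSemiAnbd2006, Thm 3.7(iii) pp.40-41] -/
theorem metabelianLeafStar_exists_anchorFree :
    ∃ (c : TemperedPiChart (metabelianLeafStar p)) (K : Subgroup c.G), IsCompact (K : Set c.G) ∧
      (∀ (v : (metabelianLeafStar p).graph.Vertex) (H : Subgroup c.G), H ∈ verticialSubgroups c v → ¬ K ≤ H) ∧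
      ∀ (v : (metabelianLeafStar p).graph.Vertex) (H : Subgroup c.G), H ∈ verticialSubgroups c v → K ⊓ H = ⊥ := by
  have hfail := metabelianLeafStar_not_compactInVerticialAt p
  rw [(metabelianLeafStar p).compactInVerticialAt_iff_exists_verticial_of_noCore (metabelianLeafStar_noCore p)]
    at hfail
  push Not at hfail
  obtain ⟨_, c, K, hKc, hno⟩ := hfail
  refine ⟨c, K, hKc, fun v H hH hle => hno v H hH hle, fun v H hH => ?_⟩
  exact metabelianLeafStar_inf_verticial_eq_bot_of_forall_not_le p c K hKc (fun v' H' hH' hle => hno v' H' hH' hle) hH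

/-- **Packaged verdict at `𝒢⋆(p)`** (row «ANCHORED@STAR»): the ANCHORED form of Thm 3.7 (iii) HOLDS at every chart,
while the ∃-sentence FAILS and `𝒢⋆(p)` is NOT locally finite — the failure is carried by anchor-free compact
subgroups only, as at the locally finite ray `𝒢_θ`. [cite: MochizukiSemiAnbd2006, Thm 3.7(iii) pp.40-41] -/
theorem metabelianLeafStar_anchored_and_not_compactInVerticialAt :
    (∀ (c : TemperedPiChart (metabelianLeafStar p)) (K : Subgroup c.G), IsCompact (K : Set c.G) →
      ∀ (v₀ : (metabelianLeafStar p).graph.Vertex) (H₀ : Subgroup c.G), H₀ ∈ verticialSubgroups c v₀ →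
        K ⊓ H₀ ≠ ⊥ →
        ∃ (v : (metabelianLeafStar p).graph.Vertex) (H : Subgroup c.G), H ∈ verticialSubgroups c v ∧ K ≤ H) ∧
      ¬ CompactInVerticialAt (metabelianLeafStar p) ∧ ¬ (metabelianLeafStar p).graph.IsLocallyFinite :=
  ⟨fun c K hKc _ _ hH₀ hanch => metabelianLeafStar_exists_verticial_ge_of_inf_verticial_ne_bot p c K hKc hH₀ hanch,
    metabelianLeafStar_not_compactInVerticialAt p, (metabelianLeafStar_isConnected_isCountable_hasVertex p).2.2.2.2⟩

end ProfiniteSemiGraph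

end Literature.AnabelianGeometry.SemiGraphs

end
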